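import Literature.AlgebraicGeometry.Resolution.FineModels
import Mathlib.FieldTheory.IsAlgClosed.Basic
import HarnessLib

/-!
# Ultrametric continuity of a simple root (derivative form), over a valuation ring

Topic: `Literature/AlgebraicGeometry/Resolution` (valued function fields). Groundwork for the
algebraization step of M. Temkin, *Inseparable local uniformization*, J. Algebra 373 (2013) =
arXiv:0804.1554v3, Thm. 3.3.1 (tree: `Temkin2013RelativeCurveSmoothFibre`): the second `K`-side
Hensel chart needs the centre `a` of the deep disc as a simple root of a polynomial with
coefficients in the (non-henselian) level field whose OTHER roots are far from `a`; the deep-disc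
theorems (`GeneratorDeepCentres.lean`) give such a polynomial `f` only with coefficients in the
henselization, and it is RATIONALIZED by approximating its coefficients from the dense level field.
This file proves the required continuity of roots in valuation language (Mathlib has the normed
version, `Polynomial.exists_roots_norm_sub_lt_of_norm_coeff_sub_lt`): for monic `f, g` of the
same degree `d` over an algebraically closed `(Ω, V)` with coefficients in `O_V`, a simple root
`a ∈ O_V` of `f` with `Λ = |f′(a)|`, and `|gᵢ − fᵢ| ≤ ε < Λᵈ` for all `i`:

* (private) `valuation_eval_sub_eval_le'` — `|p(u) − p(v)| ≤ |u − v|` for `p` over `O_V`,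
  `u, v ∈ O_V` (a lemma of `RankOneDensity.lean`, local copy) — PROVED;
* `valuation_eval_le_of_coeff_sub` — `|g(a)| ≤ ε` — PROVED;
* `exists_root_valuation_sub_pow_le` — a root `ã` of `g` with `|ã − a|ᵈ ≤ ε`, `|ã − a| < Λ` —
  PROVED;
* `exists_unique_root_near_of_coeff_close` — **moreover `|g′(ã)| = Λ` and every root `b ≠ ã` of
  `g` satisfies `|b − ã| ≥ Λ`** (so the disc `|X − ã| < Λ` is split for `g`, and `ã` is the only
  root of `g` near `a`) — PROVED;
* `exists_root_near_forall_dist_eq_of_coeff_close` — **if also `ε < |a − ρ|ᵈ` for the roots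
  `ρ ≠ a` of `f`, every root `b ≠ ã` of `g` has `|b − ã| = |a − ρ|` for some root `ρ ≠ a` of
  `f`** (the distances to the other roots are preserved) — PROVED.

All statements are [folklore]; no definitions, no named facts.

## Sources

* M. Temkin, arXiv:0804.1554v3, Lemma 3.1.3 and Prop. 3.1.7 (Krasner radius), proof of
  Thm. 3.3.1 Step 3 (the use).
* Continuity of roots: standard (cf. Mathlib `Mathlib/Analysis/Normed/Field/Approximation.lean`
  for normed fields).
-/

noncomputable section

open Polynomial

namespace Literature.AlgebraicGeometry.Resolution

universe u

variable {Ω : Type u} [Field Ω] (V : ValuationSubring Ω)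

/-! ### Elementary estimates over `O_V` -/

section Estimates

/-- `|p(u) − p(v)| ≤ |u − v|` for a polynomial with coefficients in `O_V` and `u, v ∈ O_V`.
[folklore] -/
private theorem valuation_eval_sub_eval_le' {p : Polynomial Ω} (hp : ∀ i, p.coeff i ∈ V) {u v : Ω}
    (hu : u ∈ V) (hv : v ∈ V) : V.valuation (p.eval u - p.eval v) ≤ V.valuation (u - v) := by
  -- lift to `O_V` and use `u − v ∣ p(u) − p(v)` there
  have hl : p ∈ Polynomial.lifts (algebraMap V Ω) := by
    refine (Polynomial.lifts_iff_coeff_lifts _).mpr fun i => ?_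
    exact ⟨⟨p.coeff i, hp i⟩, rfl⟩
  obtain ⟨q, hq⟩ := (Polynomial.mem_lifts _).mp hl
  obtain ⟨r, hr⟩ := Polynomial.sub_dvd_eval_sub (⟨u, hu⟩ : V) ⟨v, hv⟩ q
  have h2 : ∀ w : V, p.eval (w : Ω) = ((q.eval w : V) : Ω) := fun w => by
    rw [← hq, eval_map]
    exact Polynomial.eval₂_hom (algebraMap V Ω) w
  have h1 : p.eval u - p.eval v = (u - v) * (r : Ω) := by
    rw [show u = ((⟨u, hu⟩ : V) : Ω) from rfl, show v = ((⟨v, hv⟩ : V) : Ω) from rfl, h2, h2]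
    have := congrArg (fun z : V => (z : Ω)) hr
    simpa using this
  rw [h1, map_mul]
  calc V.valuation (u - v) * V.valuation (r : Ω) ≤ V.valuation (u - v) * 1 :=
        mul_le_mul' le_rfl ((V.valuation_le_one_iff _).mpr r.2)
    _ = V.valuation (u - v) := mul_one _

/-- If the coefficients of `g − f` have value `≤ ε` and `a ∈ O_V` then `|g(a) − f(a)| ≤ ε`.
[folklore] -/
theorem valuation_eval_sub_le_of_coeff_sub {f g : Polynomial Ω} {a : Ω} (ha : a ∈ V)
    {ε : V.ValueGroup} (hε : ∀ i, V.valuation (g.coeff i - f.coeff i) ≤ ε) :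
    V.valuation (g.eval a - f.eval a) ≤ ε := by
  rw [← eval_sub, eval_eq_sum_range]
  refine Valuation.map_sum_le _ fun i _ => ?_
  rw [map_mul, map_pow, coeff_sub]
  calc V.valuation (g.coeff i - f.coeff i) * V.valuation a ^ i ≤ ε * 1 :=
        mul_le_mul' (hε i) (pow_le_one₀ zero_le ((V.valuation_le_one_iff _).mpr ha))
    _ = ε := mul_one ε

end Estimates

/-! ### A root of `g` near the simple root `a` of `f`, and its isolation -/

section Roots

variable [IsAlgClosed Ω]

/-- **A root of `g` near `a`.** `f, g` monic of the same degree `d ≥ 1` with coefficients of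
`g − f` of value `≤ ε`, `a ∈ O_V` a root of `f`: some root `ã` of `g` has `|ã − a|ᵈ ≤ ε`.
[folklore] -/
theorem exists_root_valuation_sub_pow_le {f g : Polynomial Ω} (hgm : g.Monic)
    (hdeg : g.natDegree = f.natDegree) (hd : 1 ≤ f.natDegree) {a : Ω} (ha : a ∈ V)
    (hfa : f.eval a = 0) {ε : V.ValueGroup} (hε : ∀ i, V.valuation (g.coeff i - f.coeff i) ≤ ε) :
    ∃ b ∈ g.roots, V.valuation (a - b) ^ f.natDegree ≤ ε := by
  classical
  have hsp : g.Splits := IsAlgClosed.splits g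
  have hcard : Multiset.card g.roots = f.natDegree := by
    rw [← hdeg]; exact hsp.natDegree_eq_card_roots.symm
  have hne : g.roots ≠ 0 := by
    intro h0
    rw [h0, Multiset.card_zero] at hcard
    omega
  -- the product of the distances is `|g(a)| ≤ ε`
  have hga : V.valuation (g.eval a) ≤ ε := by
    have h := valuation_eval_sub_le_of_coeff_sub V ha hε
    rwa [hfa, sub_zero] at h
  have hprod : V.valuation (g.eval a) = (g.roots.map fun b => V.valuation (a - b)).prod := by
    rw [hsp.eval_eq_prod_roots_of_monic hgm, map_multiset_prod, Multiset.map_map]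
    rfl
  -- a root at minimal distance
  obtain ⟨b, hb, hmin⟩ := Multiset.exists_min_image (fun b => V.valuation (a - b)) hne
  refine ⟨b, hb, ?_⟩
  have hle : V.valuation (a - b) ^ f.natDegree ≤ (g.roots.map fun b => V.valuation (a - b)).prod := by
    rw [← hcard, ← Multiset.card_map (fun b => V.valuation (a - b)) g.roots]
    refine Multiset.pow_card_le_prod fun x hx => ?_
    obtain ⟨b', hb', rfl⟩ := Multiset.mem_map.mp hx
    exact hmin b' hb'
  exact hle.trans (hprod ▸ hga)

/-- **Continuity of a simple root, derivative form.** `f, g` monic of the same degree `d` with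
coefficients in `O_V`, `a ∈ O_V` with `f(a) = 0`, `f′(a) ≠ 0`, `Λ = |f′(a)|`, and
`|gᵢ − fᵢ| ≤ ε < Λᵈ` for all `i`. Then there is a root `ã` of `g` with `|ã − a|ᵈ ≤ ε`,
`|ã − a| < Λ`, `|g′(ã)| = Λ`, and `|b − ã| ≥ Λ` for every root `b ≠ ã` of `g`. [folklore] -/
theorem exists_unique_root_near_of_coeff_close {f g : Polynomial Ω} (hfm : f.Monic) (hgm : g.Monic)
    (hdeg : g.natDegree = f.natDegree) (hfV : ∀ i, f.coeff i ∈ V) (hgV : ∀ i, g.coeff i ∈ V)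
    {a : Ω} (ha : a ∈ V) (hfa : f.eval a = 0) (hfa' : (derivative f).eval a ≠ 0)
    {ε : V.ValueGroup} (hε : ∀ i, V.valuation (g.coeff i - f.coeff i) ≤ ε)
    (hεΛ : ε < V.valuation ((derivative f).eval a) ^ f.natDegree) :
    ∃ ã : Ω, g.eval ã = 0 ∧ ã ∈ V ∧ V.valuation (ã - a) ^ f.natDegree ≤ ε ∧
      V.valuation (ã - a) < V.valuation ((derivative f).eval a) ∧
      V.valuation ((derivative g).eval ã) = V.valuation ((derivative f).eval a) ∧
      ∀ b : Ω, g.eval b = 0 → b ≠ ã → V.valuation ((derivative f).eval a) ≤ V.valuation (b - ã) := by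
  classical
  set d := f.natDegree with hd
  set Λ := V.valuation ((derivative f).eval a) with hΛ
  have hsp : g.Splits := IsAlgClosed.splits g
  have hΛ0 : 0 < Λ := (Valuation.pos_iff _).mpr hfa'
  have hd1 : 1 ≤ d := by
    by_contra h0
    have h0' : f.natDegree = 0 := by omega
    have : f = 1 := (Polynomial.Monic.natDegree_eq_zero hfm).mp h0'
    rw [this, eval_one] at hfa
    exact one_ne_zero hfa
  -- `Λ ≤ 1`
  have hf'V : ∀ i, (derivative f).coeff i ∈ V := fun i => by
    rw [coeff_derivative]
    exact mul_mem (hfV _) (add_mem (natCast_mem V i) (one_mem V))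
  have hΛ1 : Λ ≤ 1 := by
    rw [hΛ, eval_eq_sum_range]
    refine Valuation.map_sum_le _ fun i _ => ?_
    rw [map_mul, map_pow]
    exact mul_le_one' ((V.valuation_le_one_iff _).mpr (hf'V i))
      (pow_le_one₀ zero_le ((V.valuation_le_one_iff _).mpr ha))
  -- the root `ã`
  obtain ⟨ã, hãroot, hãε⟩ := exists_root_valuation_sub_pow_le V hgm hdeg hd1 ha hfa hε
  have hgã : g.eval ã = 0 := (mem_roots hgm.ne_zero).mp hãroot
  rw [Valuation.map_sub_swap] at hãε
  -- `|ã − a| < Λ`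
  have hãΛ : V.valuation (ã - a) < Λ := by
    by_contra hle
    push Not at hle
    have h1 : Λ ^ d ≤ V.valuation (ã - a) ^ d := pow_le_pow_left₀ zero_le hle d
    exact absurd (h1.trans hãε) (not_le.mpr hεΛ)
  -- `ã ∈ O_V` (roots of a monic polynomial over `O_V`)
  have hãV : ã ∈ V := by
    have h1 : V.valuation (ã - a) ≤ 1 := hãΛ.le.trans hΛ1
    have h2 : ã = (ã - a) + a := by ring
    rw [h2]
    exact add_mem ((V.valuation_le_one_iff _).mp h1) ha
  -- `|g′(ã)| = Λ`
  have hderiv : V.valuation ((derivative g).eval ã) = Λ := by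
    have h1 : V.valuation ((derivative g).eval ã - (derivative f).eval ã) ≤ ε := by
      refine valuation_eval_sub_le_of_coeff_sub V hãV fun i => ?_
      rw [coeff_derivative, coeff_derivative, ← sub_mul, map_mul]
      calc V.valuation (g.coeff (i + 1) - f.coeff (i + 1)) * V.valuation ((i : Ω) + 1) ≤ ε * 1 :=
            mul_le_mul' (hε _) ((V.valuation_le_one_iff _).mpr (add_mem (natCast_mem V i) (one_mem V)))
        _ = ε := mul_one ε
    have h2 : V.valuation ((derivative f).eval ã - (derivative f).eval a) ≤ V.valuation (ã - a) :=
      valuation_eval_sub_eval_le' V hf'V hãV ha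
    have hεΛ' : ε < Λ := by
      refine lt_of_lt_of_le hεΛ ?_
      exact pow_le_of_le_one zero_le hΛ1 (by omega)
    have h3 : V.valuation ((derivative g).eval ã - (derivative f).eval a) < Λ := by
      have : (derivative g).eval ã - (derivative f).eval a =
          ((derivative g).eval ã - (derivative f).eval ã) + ((derivative f).eval ã - (derivative f).eval a) := by
        ring
      rw [this]
      exact lt_of_le_of_lt (Valuation.map_add _ _ _) (max_lt (lt_of_le_of_lt h1 hεΛ') (lt_of_le_of_lt h2 hãΛ))
    have : (derivative g).eval ã = ((derivative g).eval ã - (derivative f).eval a) + (derivative f).eval a := by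
      ring
    rw [this, Valuation.map_add_eq_of_lt_right _ h3]
  refine ⟨ã, hgã, hãV, hãε, hãΛ, hderiv, fun b hb hbã => ?_⟩
  -- the other roots are far: `g′(ã) = ∏_{b ≠ ã} (ã − b)` and each factor is `≤ 1`
  have hbroot : b ∈ g.roots := (mem_roots hgm.ne_zero).mpr hb
  have hbV : ∀ b' ∈ g.roots, b' ∈ V := by
    intro b' hb'
    -- roots of a monic polynomial over `O_V` are integral over `O_V`
    refine mem_valuationSubring_of_isIntegral_subring V (S := V.toSubring) le_rfl ?_
    exact isIntegral_of_monic_of_coeff_mem V.toSubring hgm hgV ((mem_roots hgm.ne_zero).mp hb')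
  have hprod : (derivative g).eval ã = ((g.roots.erase ã).map (ã - ·)).prod :=
    hsp.eval_root_derivative hgm hãroot
  have hberase : b ∈ g.roots.erase ã := (Multiset.mem_erase_of_ne hbã).mpr hbroot
  by_contra hlt
  push Not at hlt
  -- then `|g′(ã)| < Λ`, contradiction
  have hfac : ∀ b' ∈ g.roots.erase ã, V.valuation (ã - b') ≤ 1 := fun b' hb' => by
    have hb'V : b' ∈ V := hbV b' (Multiset.mem_of_mem_erase hb')
    exact (V.valuation_le_one_iff _).mpr (sub_mem hãV hb'V)
  obtain ⟨t, ht⟩ := Multiset.exists_cons_of_mem hberase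
  have hall : ∀ y ∈ t.map (V.valuation ∘ fun x => ã - x), y ≤ (1 : V.ValueGroup) := by
    intro y hy
    obtain ⟨b', hb't, rfl⟩ := Multiset.mem_map.mp hy
    have hb'e : b' ∈ g.roots.erase ã := by rw [ht]; exact Multiset.mem_cons_of_mem hb't
    exact hfac b' hb'e
  have ht1 : (t.map (V.valuation ∘ fun x => ã - x)).prod ≤ 1 := by
    have h := Multiset.prod_le_pow_card (t.map (V.valuation ∘ fun x => ã - x)) 1 hall
    rwa [one_pow] at h
  have h1 : V.valuation ((derivative g).eval ã) < Λ := by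
    rw [hprod, map_multiset_prod, Multiset.map_map, ht, Multiset.map_cons, Multiset.prod_cons]
    calc (V.valuation ∘ fun x => ã - x) b * (t.map (V.valuation ∘ fun x => ã - x)).prod
        ≤ V.valuation (ã - b) * 1 := mul_le_mul' le_rfl ht1
      _ = V.valuation (ã - b) := mul_one _
      _ < Λ := by rw [Valuation.map_sub_swap]; exact hlt
  rw [hderiv] at h1
  exact lt_irrefl _ h1

/-- **The other roots keep their distances.** In the situation of
`exists_unique_root_near_of_coeff_close`, if moreover `ε < |a − ρ|ᵈ` for every root `ρ ≠ a` of
`f`, then there is a root `ã` of `g` as there such that every root `b ≠ ã` of `g` lies near a root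
`ρ ≠ a` of `f`, at the SAME distance from `ã` as `ρ` from `a`: `|b − ã| = |a − ρ|` (so a disc
`|X − a| ≤ |c|` with `|c| < |a − ρ|` for all `ρ ≠ a` is split for `g` around `ã` as well).
[folklore] -/
theorem exists_root_near_forall_dist_eq_of_coeff_close {f g : Polynomial Ω} (hfm : f.Monic)
    (hgm : g.Monic) (hdeg : g.natDegree = f.natDegree) (hfV : ∀ i, f.coeff i ∈ V)
    (hgV : ∀ i, g.coeff i ∈ V) {a : Ω} (ha : a ∈ V) (hfa : f.eval a = 0)
    (hfa' : (derivative f).eval a ≠ 0) {ε : V.ValueGroup}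
    (hε : ∀ i, V.valuation (g.coeff i - f.coeff i) ≤ ε)
    (hεΛ : ε < V.valuation ((derivative f).eval a) ^ f.natDegree)
    (hεr : ∀ ρ : Ω, f.eval ρ = 0 → ρ ≠ a → ε < V.valuation (a - ρ) ^ f.natDegree) :
    ∃ ã : Ω, g.eval ã = 0 ∧ ã ∈ V ∧ V.valuation (ã - a) ^ f.natDegree ≤ ε ∧
      V.valuation (ã - a) < V.valuation ((derivative f).eval a) ∧
      V.valuation ((derivative g).eval ã) = V.valuation ((derivative f).eval a) ∧
      (∀ b : Ω, g.eval b = 0 → b ≠ ã → V.valuation ((derivative f).eval a) ≤ V.valuation (b - ã)) ∧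
      ∀ b : Ω, g.eval b = 0 → b ≠ ã →
        ∃ ρ : Ω, f.eval ρ = 0 ∧ ρ ≠ a ∧ V.valuation (ã - a) < V.valuation (a - ρ) ∧
          V.valuation (b - ã) = V.valuation (a - ρ) := by
  classical
  obtain ⟨ã, hgã, hãV, hãε, hãΛ, hderiv, hfar⟩ :=
    exists_unique_root_near_of_coeff_close V hfm hgm hdeg hfV hgV ha hfa hfa' hε hεΛ
  refine ⟨ã, hgã, hãV, hãε, hãΛ, hderiv, hfar, fun b hb hbã => ?_⟩
  set d := f.natDegree with hd
  have hfsp : f.Splits := IsAlgClosed.splits f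
  have hd1 : 1 ≤ d := by
    by_contra h0
    have h0' : f.natDegree = 0 := by omega
    have : f = 1 := (Polynomial.Monic.natDegree_eq_zero hfm).mp h0'
    rw [this, eval_one] at hfa
    exact one_ne_zero hfa
  -- `b ∈ O_V`
  have hbV : b ∈ V := by
    refine mem_valuationSubring_of_isIntegral_subring V (S := V.toSubring) le_rfl ?_
    exact isIntegral_of_monic_of_coeff_mem V.toSubring hgm hgV hb
  -- a root `ρ` of `f` with `|b − ρ|ᵈ ≤ ε` (symmetric use of `exists_root_valuation_sub_pow_le`)
  have hε' : ∀ i, V.valuation (f.coeff i - g.coeff i) ≤ ε := fun i => by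
    rw [Valuation.map_sub_swap]; exact hε i
  obtain ⟨ρ, hρroot, hρε⟩ :=
    exists_root_valuation_sub_pow_le V hfm hdeg.symm (by rw [hdeg]; exact hd1) hbV hb hε'
  rw [hdeg] at hρε
  have hfρ : f.eval ρ = 0 := (mem_roots hfm.ne_zero).mp hρroot
  -- `ρ ≠ a`: otherwise `b` would be a second root of `g` within `Λ` of `a`
  have hρa : ρ ≠ a := by
    intro hρa
    rw [hρa] at hρε
    have h1 : V.valuation (b - a) < V.valuation ((derivative f).eval a) := by
      by_contra hle
      push Not at hle
      exact absurd ((pow_le_pow_left₀ zero_le hle d).trans hρε) (not_le.mpr hεΛ)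
    have h2 : V.valuation (b - ã) < V.valuation ((derivative f).eval a) := by
      have : b - ã = (b - a) + (a - ã) := by ring
      rw [this]
      refine lt_of_le_of_lt (Valuation.map_add _ _ _) (max_lt h1 ?_)
      rw [Valuation.map_sub_swap]; exact hãΛ
    exact absurd (hfar b hb hbã) (not_le.mpr h2)
  -- the three distances
  have hbρ : V.valuation (b - ρ) < V.valuation (a - ρ) := by
    by_contra hle
    push Not at hle
    exact absurd ((pow_le_pow_left₀ zero_le hle d).trans hρε) (not_le.mpr (hεr ρ hfρ hρa))
  have hãa : V.valuation (ã - a) < V.valuation (a - ρ) := by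
    by_contra hle
    push Not at hle
    exact absurd ((pow_le_pow_left₀ zero_le hle d).trans hãε) (not_le.mpr (hεr ρ hfρ hρa))
  refine ⟨ρ, hfρ, hρa, hãa, ?_⟩
  have hsplit : b - ã = (ρ - a) + ((b - ρ) + (a - ã)) := by ring
  have hsmall : V.valuation ((b - ρ) + (a - ã)) < V.valuation (ρ - a) := by
    refine lt_of_le_of_lt (Valuation.map_add _ _ _) (max_lt ?_ ?_)
    · rw [Valuation.map_sub_swap V.valuation ρ a]; exact hbρ
    · rw [Valuation.map_sub_swap V.valuation ρ a, Valuation.map_sub_swap V.valuation a ã]; exact hãa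
  rw [hsplit, Valuation.map_add_eq_of_lt_left _ hsmall, Valuation.map_sub_swap]

end Roots

end Literature.AlgebraicGeometry.Resolution

end
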